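import Summits.BirchSwinnertonDyer.BirchSwinnertonDyer.Theorems.ManinLocalTwoThreeNotTrivialEisensteinAtTwo
import HarnessLib

/-!
# E-es-40 at the primes `t ≡ 2 (mod 3)`, and the Chebotarev core of E-es-40 for every prime `t`

Route `ManinLocalTwoThree` (cell bsd-f2-manin), crux C2 `ManinOddAtFour` (stmt-BirchSwinnertonDyer-22967), line `kato_shift_two` v8,
stub 5 `stub_notTrivialEisensteinTwo : NotTrivialEisensteinOfIrreducibleTwo` (E-es-40; `t = 2` is the lead's p610460).  Contents:
§1–§2 the lead's plumbing for an arbitrary prime `t` (exact-order-`t^{k+1}` points from `#E[n] = n²`; `Frob_ℓ ζ = ζ^ℓ` on `t`-power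
roots of unity, `ℓ ≠ t`); §3 the structure of `W[2]` (on an elementary abelian `2`-group with four elements a fixed-point-free `τ` has
`τ²a = a + τa`, so `τ³ = 1` and `τ^k` is fixed-point-free for `3 ∤ k`); §4 **Theorem A**
`exists_prime_modEq_one_reductionPointCount_odd_of_exists_fixedPointFree` — for ANY prime `t`: if for every primitive `t^{M+1}`-th
root of unity `ζ` some `σ ∈ Γ_ℚ` fixes `ζ` and is fixed-point-free on `W[2]`, there are good primes `ℓ ∉ S`, `ℓ ≡ 1 (mod t^{M+1})`, with
`#W̃(𝔽_ℓ)` odd (Chebotarev `chebotarev_geomTorsion_holds` on `W[2·t^{M+1}]`, `μ ⊂ ℚ(W[t^{M+1}])` by `exists_isPrimitiveRoot_fixed`,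
reduction of torsion); §5 **Theorem B** `exists_fixedPointFree_smul_eq_of_not_three_dvd_totient` — that hypothesis holds when
`3 ∤ φ(t^{M+1})` (`σ := τ^{φ(t^{M+1})}`, Euler + §3); §6 **`notTrivialEisensteinOfIrreducibleTwo_of_mod_three`**: E-es-40 for all
primes `t ≡ 2 (mod 3)`, with NO condition on the level.  WHAT REMAINS of stub 5: `t = 3` and `t ≡ 1 (mod 3)`, where Theorem A's
hypothesis fails exactly when `ℚ(W[2])` is the cubic subfield of `ℚ(ζ_{t^{M+1}})` — excluded by `t² ∤ N` through ramification at
`t` (cell INBOX 2026-08-28, lead's analysis).  No new definitions; axioms standard; nothing about BSD or Manin's conjecture is proved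
here.  References: J. Tate, GCFT (Cassels–Fröhlich 1967) §2.4; J.-P. Serre, Invent. Math. 15 (1972) §4; J. H. Silverman, *AEC*
III.6.4, III.8.1.1, VII.3.1; HOME/MEMO-es.md §25.1.
-/

set_option autoImplicit false
set_option linter.dupNamespace false

noncomputable section

open scoped Classical

open NumberField IsDedekindDomain Field WeierstrassCurve
  Literature.NumberTheory.EllipticCurves Literature.NumberTheory.GaloisRepresentations
  Summit.BirchSwinnertonDyer.Rank1Residual.ManinAdditive

namespace Summit.BirchSwinnertonDyer.BirchSwinnertonDyer.Theorems.ManinLocalTwoThree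

/-! ### §1  A point of exact order `p^{k+1}` (any prime `p`) -/
section ExactOrderPrime

/-- `E[p^{k+1}]` contains a point not killed by `p^k` (`#E[n] = n²`). [cite: SilvermanAEC2009, Cor. III.6.4(b)] -/
theorem exists_geomTorsion_not_killed_prime (W : WeierstrassCurve ℚ) [W.IsElliptic] {p : ℕ} (hp : p.Prime) (k : ℕ) :
    ∃ T : W.geomPoints, ((p ^ (k + 1) : ℕ) : ℤ) • T = 0 ∧ ((p ^ k : ℕ) : ℤ) • T ≠ 0 := by
  by_contra h
  push Not at h
  have hle : W.geomTorsion ((p ^ (k + 1) : ℕ) : ℤ) ≤ W.geomTorsion ((p ^ k : ℕ) : ℤ) := by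
    intro T hT
    have hT' : ((p ^ (k + 1) : ℕ) : ℤ) • T = 0 := by
      simpa only [AddSubgroup.torsionBy, Submodule.mem_toAddSubgroup, Submodule.mem_torsionBy_iff] using hT
    have := h T hT'
    simpa only [AddSubgroup.torsionBy, Submodule.mem_toAddSubgroup, Submodule.mem_torsionBy_iff] using this
  have hp0 : p ≠ 0 := hp.ne_zero
  have h1 : Nat.card (W.geomTorsion ((p ^ (k + 1) : ℕ) : ℤ)) = (p ^ (k + 1)) ^ 2 :=
    card_torsionPoints_eq_sq_holds W (AlgebraicClosure ℚ) (n := p ^ (k + 1))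
      (by exact_mod_cast (pow_ne_zero (k + 1) hp0 : (p : ℕ) ^ (k + 1) ≠ 0))
  have h2 : Nat.card (W.geomTorsion ((p ^ k : ℕ) : ℤ)) = (p ^ k) ^ 2 :=
    card_torsionPoints_eq_sq_holds W (AlgebraicClosure ℚ) (n := p ^ k)
      (by exact_mod_cast (pow_ne_zero k hp0 : (p : ℕ) ^ k ≠ 0))
  haveI : Finite (W.geomTorsion ((p ^ k : ℕ) : ℤ)) :=
    Nat.finite_of_card_ne_zero (by rw [h2]; exact pow_ne_zero _ (pow_ne_zero _ hp0))
  have hcard := AddSubgroup.card_le_of_le hle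
  rw [h1, h2] at hcard
  have : (p ^ k) ^ 2 < (p ^ (k + 1)) ^ 2 := by
    apply Nat.pow_lt_pow_left _ two_ne_zero
    exact Nat.pow_lt_pow_right hp.one_lt (Nat.lt_succ_self k)
  omega

/-- A point of exact order `p^{k+1}`: `d • T ≠ 0` for `0 < d < p^{k+1}`. [cite: SilvermanAEC2009, Cor. III.6.4(b)] -/
theorem exists_geomTorsion_exactOrder_prime (W : WeierstrassCurve ℚ) [W.IsElliptic] {p : ℕ} (hp : p.Prime) (k : ℕ) :
    ∃ T : W.geomPoints, ((p ^ (k + 1) : ℕ) : ℤ) • T = 0 ∧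
      ∀ d : ℕ, 0 < d → d < p ^ (k + 1) → (d : ℤ) • T ≠ 0 := by
  obtain ⟨T, hT, hT'⟩ := exists_geomTorsion_not_killed_prime W hp k
  refine ⟨T, hT, fun d hd hdq hd0 ↦ hT' ?_⟩
  set q : ℕ := p ^ (k + 1) with hq
  have hg : ((Nat.gcd d q : ℕ) : ℤ) • T = 0 := by
    have e : ((Nat.gcd d q : ℕ) : ℤ) = (d : ℤ) * Nat.gcdA d q + (q : ℤ) * Nat.gcdB d q := Nat.gcd_eq_gcd_ab d q
    rw [e, add_smul, mul_comm (d : ℤ), mul_smul, hd0, smul_zero, mul_comm (q : ℤ), mul_smul]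
    rw [hq] at hT ⊢
    rw [hT, smul_zero, add_zero]
  obtain ⟨j, hj, hgj⟩ := (Nat.dvd_prime_pow hp).mp (Nat.gcd_dvd_right d q)
  have hjk : j ≤ k := by
    by_contra hjk
    have hj' : j = k + 1 := by omega
    have hle : Nat.gcd d q ≤ d := Nat.le_of_dvd hd (Nat.gcd_dvd_left d q)
    rw [hgj, hj'] at hle
    omega
  obtain ⟨c, hc⟩ : p ^ j ∣ p ^ k := Nat.pow_dvd_pow p hjk
  rw [hc, Nat.cast_mul, mul_comm, mul_smul, ← hgj, hg, smul_zero]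

end ExactOrderPrime

/-! ### §2  Frobenius on `t`-power roots of unity, `ℓ ≠ t` -/

section FrobRootPrime

/-- An arithmetic Frobenius over a prime `ℓ ≠ t` raises `t`-power roots of unity to the `ℓ`-th power.
[cite: TateGCFT1967, §3.4 Proposition (PDF p. 208)] -/
theorem frob_smul_eq_pow_of_pow_eq_one_prime {ℓ t k : ℕ} (hℓ : ℓ.Prime) (ht : t.Prime) (hℓt : ℓ ≠ t)
    {v : HeightOneSpectrum (𝓞 ℚ)} (hv : (ℓ : 𝓞 ℚ) ∈ v.asIdeal) {𝔓 : Ideal (absIntegers (𝓞 ℚ) ℚ)}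
    (h𝔓 : 𝔓 ∈ v.primesAbove) {φ : absoluteGaloisGroup ℚ} (hφ : IsArithFrobAt (𝓞 ℚ) φ 𝔓) {ζ : AlgebraicClosure ℚ}
    (hζ : ζ ^ t ^ k = 1) : φ • ζ = ζ ^ ℓ := by
  haveI : 𝔓.IsPrime := h𝔓.1
  have hvℓ : (Rat.HeightOneSpectrum.primesEquiv v : ℕ) = ℓ := primesEquiv_eq_of_natCast_mem hℓ hv
  have htv : ((t : ℕ) : 𝓞 ℚ) ∉ v.asIdeal := fun h ↦
    hℓt (hvℓ.symm.trans (primesEquiv_eq_of_natCast_mem ht h))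
  have hζi : IsIntegral (𝓞 ℚ) ζ :=
    IsIntegral.of_pow (pos_of_ne_zero (pow_ne_zero k ht.ne_zero)) (by rw [hζ]; exact isIntegral_one)
  set x : absIntegers (𝓞 ℚ) ℚ := ⟨ζ, hζi⟩ with hx
  have hxN : x ^ t ^ k = 1 := Subtype.ext (by simp [hx, hζ])
  have hm : ((t ^ k : ℕ) : absIntegers (𝓞 ℚ) ℚ) ∉ 𝔓 := by
    intro h
    apply htv
    rw [h𝔓.2.over, Ideal.mem_under, map_natCast]
    rw [Nat.cast_pow] at h
    exact Ideal.IsPrime.mem_of_pow_mem inferInstance k h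
  have h := hφ.apply_of_pow_eq_one hxN hm
  rw [MulSemiringAction.toAlgHom_apply, HeightOneSpectrum.card_quotient_under_eq_residueCard h𝔓] at h
  have hres : v.residueCard = ℓ := by rw [FramedRep.residueCard_eq_coe_primesEquiv', hvℓ]
  have h' := congrArg (fun z : absIntegers (𝓞 ℚ) ℚ ↦ (z : AlgebraicClosure ℚ)) h
  simpa [hx, integralClosure.coe_smul, hres] using h'

end FrobRootPrime

/-! ### §3  A fixed-point-free automorphism of `W[2]` has order `3` -/

section OrderThree

variable {G A : Type*} [Group G] [AddCommGroup A] [DistribMulAction G A]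

/-- On an elementary abelian `2`-group with exactly four elements, a fixed-point-free automorphism `τ` satisfies
`τ²a = a + τa` for `a ≠ 0` (the four elements are `0, a, τa, a + τa`, and `τ²a ∉ {0, a, τa}`). [folklore] -/
theorem smul_smul_eq_add (h2 : ∀ a : A, a + a = 0) (hcard : Nat.card A = 4) {τ : G}
    (hτ : ∀ a : A, a ≠ 0 → τ • a ≠ a) (a : A) (ha : a ≠ 0) : τ • τ • a = a + τ • a := by
  haveI : Finite A := Nat.finite_of_card_ne_zero (by rw [hcard]; norm_num)
  letI : Fintype A := Fintype.ofFinite A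
  have hb : τ • a ≠ a := hτ a ha
  have hb0 : τ • a ≠ 0 := fun h ↦ ha ((smul_eq_zero_iff_eq τ).mp h)
  have hneg : ∀ x : A, -x = x := fun x ↦ (neg_eq_of_add_eq_zero_left (h2 x))
  have hsum0 : a + τ • a ≠ 0 := by
    intro h0
    have h1 : τ • a = -a := eq_neg_of_add_eq_zero_right h0
    rw [hneg] at h1
    exact hb h1
  have hsuma : a + τ • a ≠ a := fun h ↦ hb0 (by simpa using h)
  have hsumb : a + τ • a ≠ τ • a := fun h ↦ ha (by simpa using h)
  -- the four elements exhaust `A`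
  let s : Finset A := {0, a, τ • a, a + τ • a}
  have hs : s.card = 4 := by
    simp only [s]
    rw [Finset.card_insert_of_notMem, Finset.card_insert_of_notMem, Finset.card_insert_of_notMem,
      Finset.card_singleton]
    · simp only [Finset.mem_singleton]; exact fun h ↦ hsumb h.symm
    · simp only [Finset.mem_insert, Finset.mem_singleton, not_or]; exact ⟨hb.symm, fun h ↦ hsuma h.symm⟩
    · simp only [Finset.mem_insert, Finset.mem_singleton, not_or]
      exact ⟨fun h ↦ ha h.symm, fun h ↦ hb0 h.symm, fun h ↦ hsum0 h.symm⟩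
  have hsu : s = Finset.univ := Finset.eq_univ_of_card s (by rw [hs, ← Nat.card_eq_fintype_card, hcard])
  have hmem : τ • τ • a ∈ s := by rw [hsu]; exact Finset.mem_univ _
  have hc0 : τ • τ • a ≠ 0 := fun h ↦ hb0 ((smul_eq_zero_iff_eq τ).mp h)
  have hcb : τ • τ • a ≠ τ • a := hτ (τ • a) hb0
  have hca : τ • τ • a ≠ a := by
    have := smul_ne_self_of_sq h2 hτ a ha
    rwa [mul_smul] at this
  simp only [s, Finset.mem_insert, Finset.mem_singleton] at hmem
  rcases hmem with h | h | h | h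
  · exact (hc0 h).elim
  · exact (hca h).elim
  · exact (hcb h).elim
  · exact h

/-- Hence `τ³ = 1` on such a group. [folklore] -/
theorem smul_smul_smul_eq_self (h2 : ∀ a : A, a + a = 0) (hcard : Nat.card A = 4) {τ : G}
    (hτ : ∀ a : A, a ≠ 0 → τ • a ≠ a) (a : A) : τ • τ • τ • a = a := by
  by_cases ha : a = 0
  · rw [ha, smul_zero, smul_zero, smul_zero]
  · rw [smul_smul_eq_add h2 hcard hτ a ha, smul_add, smul_smul_eq_add h2 hcard hτ a ha, ← add_assoc, add_right_comm, h2,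
      zero_add]

/-- And `τ^k` is fixed-point-free whenever `3 ∤ k`. [folklore] -/
theorem pow_smul_ne_self_of_not_three_dvd (h2 : ∀ a : A, a + a = 0) (hcard : Nat.card A = 4) {τ : G}
    (hτ : ∀ a : A, a ≠ 0 → τ • a ≠ a) {k : ℕ} (hk : ¬ 3 ∣ k) (a : A) (ha : a ≠ 0) : (τ ^ k) • a ≠ a := by
  have h3 : ∀ j : ℕ, (τ ^ (3 * j)) • a = a := by
    intro j
    induction j with
    | zero => rw [mul_zero, pow_zero, one_smul]
    | succ j ih =>
      rw [Nat.mul_succ, pow_add, mul_smul, show τ ^ 3 = τ * τ * τ by rw [pow_succ, pow_two], mul_smul, mul_smul,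
        smul_smul_smul_eq_self h2 hcard hτ, ih]
  obtain ⟨j, r, hr, rfl⟩ : ∃ j r : ℕ, r < 3 ∧ k = r + 3 * j :=
    ⟨k / 3, k % 3, Nat.mod_lt _ (by norm_num), by have := Nat.div_add_mod k 3; omega⟩
  have hr0 : r ≠ 0 := fun h ↦ hk ⟨j, by rw [h, zero_add]⟩
  rw [pow_add, mul_smul, h3]
  interval_cases r
  · exact (hr0 rfl).elim
  · rw [pow_one]
    exact hτ a ha
  · rw [pow_two]
    exact smul_ne_self_of_sq h2 hτ a ha

end OrderThree

/-! ### §4  Theorem A: the Chebotarev core of E-es-40 at an arbitrary prime `t` -/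

section CoreOdd

/-- **Theorem A (Chebotarev core of E-es-40, any prime `t`).**  Let `W` be globally minimal with `W[2]` irreducible, `t` a prime,
`S` finite, `M : ℕ`, and suppose that for every primitive `t^{M+1}`-th root of unity `ζ ∈ \bar ℚ` some `σ ∈ Γ_ℚ` fixes `ζ` and acts
on `W[2]` without non-zero fixed point.  Then there is a good prime `ℓ ∉ S`, `ℓ ≠ 2`, `ℓ ≡ 1 (mod t^{M+1})` with `#W̃(𝔽_ℓ)` odd:
Chebotarev (`chebotarev_geomTorsion_holds`) on `W[2·t^{M+1}]` realises `σ` as a Frobenius `Frob_ℓ`; `Frob_ℓ` fixes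
`ζ ∈ ℚ(W[t^{M+1}])` (`exists_isPrimitiveRoot_fixed`), so `ζ^ℓ = ζ` (§2) and `ℓ ≡ 1`; and `Frob_ℓ` is fixed-point-free on `W[2]`,
so `2 ∤ #W̃(𝔽_ℓ)` (reduction of torsion). [cite: TateGCFT1967, §2.4 (Tchebotarev density theorem)] -/
theorem exists_prime_modEq_one_reductionPointCount_odd_of_exists_fixedPointFree (W : WeierstrassCurve ℚ) [W.IsElliptic]
    [W.IsGloballyMinimal] {t : ℕ} (ht : t.Prime) (S : Finset ℕ) (M : ℕ)
    (hex : ∀ ζ : AlgebraicClosure ℚ, IsPrimitiveRoot ζ (t ^ (M + 1)) →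
      ∃ σ : absoluteGaloisGroup ℚ, σ • ζ = ζ ∧ ∀ P : W.geomTorsion ((2 : ℕ) : ℤ), P ≠ 0 → σ • P ≠ P) :
    ∃ (r : ℕ) (_ : Fact r.Prime), r ∉ S ∧ r ≠ 2 ∧ r ≡ 1 [MOD t ^ (M + 1)] ∧ W.HasGoodReductionAtPrime r ∧
      ¬ 2 ∣ W.reductionPointCount r := by
  classical
  haveI : Fact (Nat.Prime 2) := ⟨Nat.prime_two⟩
  have htpos : 0 < t ^ (M + 1) := pow_pos ht.pos _
  haveI : NeZero (t ^ (M + 1)) := ⟨htpos.ne'⟩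
  have hq2 : 2 ≤ t ^ (M + 1) :=
    le_trans ht.two_le (by simpa using Nat.pow_le_pow_right ht.pos (Nat.le_add_left 1 M))
  -- the root of unity and the element `σ`
  obtain ⟨ζ, hζ, hζfix⟩ :=
    exists_isPrimitiveRoot_fixed (E := W) (q := t ^ (M + 1)) hq2 (exists_geomTorsion_exactOrder_prime W ht M)
  obtain ⟨σ, hσζ, hσ⟩ := hex ζ hζ
  -- Chebotarev on `W[2 t^{M+1}]` off `S ∪ {2, t} ∪ {bad primes}`
  have hΔ0 : minimalDiscriminantInt W ≠ 0 := minimalDiscriminantInt_ne_zero W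
  let S' : Set ℕ := {ℓ | (ℓ = 2 ∨ ℓ = t) ∨ (ℓ : ℤ) ∣ minimalDiscriminantInt W ∨ ℓ ∈ S}
  have hS' : S'.Finite := by
    refine ((Set.finite_le_nat (max (max 2 t) (minimalDiscriminantInt W).natAbs)).union
      (S : Set ℕ).toFinite).subset ?_
    rintro ℓ ((rfl | rfl) | hℓ | hℓ)
    · exact Or.inl (Set.mem_setOf.mpr (le_max_of_le_left (le_max_left _ _)))
    · exact Or.inl (Set.mem_setOf.mpr (le_max_of_le_left (le_max_right _ _)))
    · exact Or.inl (Set.mem_setOf.mpr (le_max_of_le_right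
        (Nat.le_of_dvd (Int.natAbs_pos.mpr hΔ0) (Int.natCast_dvd.mp hℓ))))
    · exact Or.inr hℓ
  have hn0 : ((2 * t ^ (M + 1) : ℕ) : ℤ) ≠ 0 := by exact_mod_cast (Nat.mul_ne_zero two_ne_zero htpos.ne')
  obtain ⟨ℓ, v, 𝔓, φ, hℓ, hℓS, hv, h𝔓, hφ, hagree⟩ :=
    chebotarev_geomTorsion_holds W ((2 * t ^ (M + 1) : ℕ) : ℤ) hn0 S' hS' σ
  haveI : Fact ℓ.Prime := ⟨hℓ⟩
  have hℓ2 : ℓ ≠ 2 := fun h ↦ hℓS (Or.inl (Or.inl h))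
  have hℓt : ℓ ≠ t := fun h ↦ hℓS (Or.inl (Or.inr h))
  have hℓΔ : ¬ (ℓ : ℤ) ∣ minimalDiscriminantInt W := fun h ↦ hℓS (Or.inr (Or.inl h))
  have hℓS₀ : ℓ ∉ S := fun h ↦ hℓS (Or.inr (Or.inr h))
  have hgood : W.HasGoodReductionAtPrime ℓ := hasGoodReductionAtPrime_of_not_dvd W ℓ hℓΔ
  -- the Frobenius fixes `ζ`
  have hψ : ∀ T : W.geomTorsion ((t ^ (M + 1) : ℕ) : ℤ), (σ⁻¹ * φ) • T = T := by
    intro T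
    have hTq : ((t ^ (M + 1) : ℕ) : ℤ) • (T : W.geomPoints) = 0 := by
      simpa only [AddSubgroup.torsionBy, Submodule.mem_toAddSubgroup, Submodule.mem_torsionBy_iff] using T.2
    have hT2q : (T : W.geomPoints) ∈ W.geomTorsion ((2 * t ^ (M + 1) : ℕ) : ℤ) := by
      simp only [Submodule.mem_toAddSubgroup, Submodule.mem_torsionBy_iff]
      rw [Nat.cast_mul, mul_smul, hTq, smul_zero]
    have hval : φ • (T : W.geomPoints) = σ • (T : W.geomPoints) := congrArg Subtype.val (hagree ⟨T, hT2q⟩)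
    apply Subtype.ext
    rw [AddSubgroup.torsionBy.coe_smul, mul_smul, hval, inv_smul_smul]
  have hφζ : φ • ζ = ζ := by
    have h1 := hζfix _ hψ
    rw [mul_smul] at h1
    have h2' := congrArg (fun x ↦ σ • x) h1
    simp only [smul_inv_smul] at h2'
    rw [h2', hσζ]
  -- `ℓ ≡ 1 (mod t^{M+1})`
  have hfrob := frob_smul_eq_pow_of_pow_eq_one_prime (k := M + 1) hℓ ht hℓt hv h𝔓 hφ hζ.pow_eq_one
  have hℓ1 : ℓ ≡ 1 [MOD t ^ (M + 1)] := by
    have hz : ζ ^ ℓ = ζ := by rw [← hfrob, hφζ]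
    have hne : ζ ≠ 0 := hζ.ne_zero htpos.ne'
    have h1 : ζ ^ (ℓ - 1) = 1 := by
      have : ζ ^ (ℓ - 1) * ζ = 1 * ζ := by
        rw [← pow_succ, Nat.sub_add_cancel hℓ.one_le, one_mul, hz]
      exact mul_right_cancel₀ hne this
    have hdvd := (hζ.pow_eq_one_iff_dvd (ℓ - 1)).mp h1
    exact ((Nat.modEq_iff_dvd' hℓ.one_le).mpr hdvd).symm
  -- `#W̃(𝔽_ℓ)` is odd
  refine ⟨ℓ, ⟨hℓ⟩, hℓS₀, hℓ2, hℓ1, hgood, fun hdvd2 ↦ ?_⟩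
  obtain ⟨P, hP0, hP⟩ :=
    exists_frobenius_smul_eq_of_dvd_reductionPointCount_holds W 2 ℓ hℓ2 hgood hdvd2 v hv 𝔓 h𝔓 φ hφ
  have hP2 : ((2 : ℕ) : ℤ) • (P : W.geomPoints) = 0 := by
    simpa only [AddSubgroup.torsionBy, Submodule.mem_toAddSubgroup, Submodule.mem_torsionBy_iff] using P.2
  have hPq : (P : W.geomPoints) ∈ W.geomTorsion ((2 * t ^ (M + 1) : ℕ) : ℤ) := by
    simp only [Submodule.mem_toAddSubgroup, Submodule.mem_torsionBy_iff]
    rw [Nat.cast_mul, mul_comm, mul_smul, hP2, smul_zero]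
  have hval : φ • (P : W.geomPoints) = σ • (P : W.geomPoints) := congrArg Subtype.val (hagree ⟨P, hPq⟩)
  apply hσ P hP0
  apply Subtype.ext
  rw [AddSubgroup.torsionBy.coe_smul, ← hval, ← AddSubgroup.torsionBy.coe_smul, hP]

end CoreOdd

/-! ### §5  Theorem B: the fixed-point-free element exists when `3 ∤ φ(t^{M+1})` -/

section FixedPointFree

/-- **Theorem B.**  If `W[2]` is irreducible and `3 ∤ φ(q)` then for every primitive `q`-th root of unity `ζ` the power
`σ := τ^{φ(q)}` of a fixed-point-free `τ` (irreducibility, `not_irreducible_of_forall_exists_smul_eq`) fixes `ζ` (Euler,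
`τζ = ζ^a` with `a` prime to `q`) and is still fixed-point-free on `W[2]` (`τ³ = 1` on `W[2]`, §3). [folklore] -/
theorem exists_fixedPointFree_smul_eq_of_not_three_dvd_totient (W : WeierstrassCurve ℚ) [W.IsElliptic]
    (hirr : W.HasIrreducibleModPGaloisRep 2) {q : ℕ} (hq : 0 < q) (h3 : ¬ 3 ∣ Nat.totient q)
    (ζ : AlgebraicClosure ℚ) (hζ : IsPrimitiveRoot ζ q) :
    ∃ σ : absoluteGaloisGroup ℚ, σ • ζ = ζ ∧ ∀ P : W.geomTorsion ((2 : ℕ) : ℤ), P ≠ 0 → σ • P ≠ P := by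
  classical
  haveI : Fact (Nat.Prime 2) := ⟨Nat.prime_two⟩
  haveI : NeZero q := ⟨hq.ne'⟩
  obtain ⟨τ, hτ⟩ : ∃ τ : absoluteGaloisGroup ℚ, ∀ P : W.geomTorsion ((2 : ℕ) : ℤ), P ≠ 0 → τ • P ≠ P := by
    by_contra h
    push Not at h
    exact not_irreducible_of_forall_exists_smul_eq W 2 h hirr
  have h2 : ∀ P : W.geomTorsion ((2 : ℕ) : ℤ), P + P = 0 := by
    intro P
    have hP : ((2 : ℕ) : ℤ) • (P : W.geomPoints) = 0 := by
      simpa only [AddSubgroup.torsionBy, Submodule.mem_toAddSubgroup, Submodule.mem_torsionBy_iff] using P.2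
    apply Subtype.ext
    show (P : W.geomPoints) + P = 0
    rw [← two_zsmul]
    exact_mod_cast hP
  have hcard : Nat.card (W.geomTorsion ((2 : ℕ) : ℤ)) = 4 :=
    card_torsionPoints_eq_sq_holds W (AlgebraicClosure ℚ) (n := 2) (by exact_mod_cast (two_ne_zero : (2 : ℕ) ≠ 0))
  -- `τ ζ = ζ^a`, `a` prime to `q`
  have hτζq : (τ • ζ) ^ q = 1 := by rw [← smul_pow', hζ.pow_eq_one, smul_one]
  obtain ⟨a, -, ha⟩ := hζ.eq_pow_of_pow_eq_one hτζq
  have hprim : IsPrimitiveRoot (τ • ζ) q :=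
    hζ.map_of_injective (f := (show AlgebraicClosure ℚ ≃ₐ[ℚ] AlgebraicClosure ℚ from τ))
      (show AlgebraicClosure ℚ ≃ₐ[ℚ] AlgebraicClosure ℚ from τ).injective
  rw [← ha] at hprim
  have hacop : a.Coprime q := (hζ.pow_iff_coprime hq a).mp hprim
  have hpow : ∀ j : ℕ, (τ ^ j) • ζ = ζ ^ (a ^ j) := by
    intro j
    induction j with
    | zero => rw [pow_zero, one_smul, pow_zero, pow_one]
    | succ j ih => rw [pow_succ, mul_smul, ← ha, smul_pow', ih, ← pow_mul, ← pow_succ]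
  refine ⟨τ ^ Nat.totient q, ?_, pow_smul_ne_self_of_not_three_dvd h2 hcard hτ h3⟩
  rcases Nat.eq_zero_or_pos a with h0 | ha0
  · -- `a = 0` forces `q = 1`, `ζ = 1`
    rw [h0, Nat.coprime_zero_left] at hacop
    subst hacop
    rw [IsPrimitiveRoot.one_right_iff.mp hζ, smul_one]
  rw [hpow]
  have hE : a ^ Nat.totient q ≡ 1 [MOD q] := Nat.ModEq.pow_totient hacop
  have hd1 : 1 ≤ a ^ Nat.totient q := Nat.one_le_pow _ _ ha0
  obtain ⟨c, hc⟩ := (Nat.modEq_iff_dvd' hd1).mp hE.symm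
  have e : a ^ Nat.totient q = q * c + 1 := by omega
  rw [e, pow_succ, pow_mul, hζ.pow_eq_one, one_pow, one_mul]

end FixedPointFree

/-! ### §6  E-es-40 at the primes `t ≡ 2 (mod 3)` -/
/-- `3 ∤ φ(t^{M+1}) = t^M (t − 1)` for a prime `t ≡ 2 (mod 3)`. [folklore] -/
theorem not_three_dvd_totient_prime_pow {t : ℕ} (ht : t.Prime) (ht3 : t % 3 = 2) (M : ℕ) :
    ¬ 3 ∣ Nat.totient (t ^ (M + 1)) := by
  rw [Nat.totient_prime_pow ht (by omega : 0 < M + 1), Nat.add_sub_cancel]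
  intro h
  rcases (Nat.Prime.dvd_mul Nat.prime_three).mp h with h1 | h1
  · have := Nat.prime_three.dvd_of_dvd_pow h1
    omega
  · omega

/-- **E-es-40 at the primes `t ≡ 2 (mod 3)`, unconditionally in the level**: for an elliptic `W/ℚ` with `W[2]` irreducible, a prime
`t ≡ 2 (mod 3)` (this includes `t = 2`), every finite `S` and every `M`, some prime `r ∉ S` with `r ≡ 1 (mod t^M)` has `a_r(W)` odd.
Theorem A + Theorem B after reduction to a global minimal model.  (The primes `t = 3` and `t ≡ 1 (mod 3)` need in addition the
exclusion of `ℚ(W[2]) ⊆ ℚ(ζ_{t^∞})`, which is where the clause `t² ∤ N` of E-es-40 enters; not treated here.)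
[cite: TateGCFT1967, §2.4 (Tchebotarev density theorem)] -/
theorem exists_prime_modEq_one_lFunction_odd_of_mod_three (W : WeierstrassCurve ℚ) [W.IsElliptic]
    (hirr : W.HasIrreducibleModPGaloisRep 2) {t : ℕ} (ht : t.Prime) (ht3 : t % 3 = 2) (S : Finset ℕ) (M : ℕ) :
    ∃ r : ℕ, r.Prime ∧ r ∉ S ∧ r ≡ 1 [MOD t ^ M] ∧ (((W.LFunction r : ℤ) : ZMod 2)) ≠ (r : ZMod 2) + 1 := by
  classical
  obtain ⟨C, hC⟩ := WeierstrassCurve.hasGlobalMinimalModel_rat_holds W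
  haveI := hC
  have hirr' : (C • W).HasIrreducibleModPGaloisRep 2 :=
    (Mazur1978.hasIrreducibleModPGaloisRep_smul_iff W C 2).mpr hirr
  have hex := fun ζ hζ ↦ exists_fixedPointFree_smul_eq_of_not_three_dvd_totient (C • W) hirr' (pow_pos ht.pos (M + 1))
    (not_three_dvd_totient_prime_pow ht ht3 M) ζ hζ
  obtain ⟨r, hr, hrS, _, hmod, hgood, hodd⟩ :=
    exists_prime_modEq_one_reductionPointCount_odd_of_exists_fixedPointFree (C • W) ht S M hex
  refine ⟨r, hr.out, hrS, ?_, ?_⟩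
  · rw [pow_succ'] at hmod
    exact Nat.ModEq.of_mul_left t hmod
  · rw [← WeierstrassCurve.LFunction_smul W C, WeierstrassCurve.LFunction_apply_prime_eq_frobeniusTrace (C • W) r hgood]
    intro heq
    apply hodd
    have h2 : ((((r : ℤ) + 1 : ℤ)) : ZMod 2) = (((C • W).frobeniusTrace r : ℤ) : ZMod 2) := by
      rw [heq]; push_cast; ring
    have h3 := (ZMod.intCast_eq_intCast_iff_dvd_sub ((r : ℤ) + 1) ((C • W).frobeniusTrace r) 2).mp h2
    exact (dvd_frobeniusTrace_sub_iff (C • W) 2 r).mp (by exact_mod_cast h3)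

/-- **E-es-40 `NotTrivialEisensteinOfIrreducibleTwo` RESTRICTED to the primes `t ≡ 2 (mod 3)`** — the leaf's binders verbatim with
the extra hypothesis `t % 3 = 2` (the newform and the clause `t = 2 ∨ ¬ t² ∣ N` are not used in this range).
[cite: TateGCFT1967, §2.4 (Tchebotarev density theorem)] -/
theorem notTrivialEisensteinOfIrreducibleTwo_of_mod_three
    (W : WeierstrassCurve ℚ) [W.IsElliptic] {N : ℕ} [NeZero N] (f : CuspForm (CongruenceSubgroup.Gamma0 N) 2)
    (_hf : Literature.NumberTheory.EllipticCurves.ModularForms.IsNewformOf W f) (hirr : W.HasIrreducibleModPGaloisRep 2)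
    (t : ℕ) (ht : t.Prime) (_ht2 : t = 2 ∨ ¬ t ^ 2 ∣ N) (ht3 : t % 3 = 2) (S : Finset ℕ) (M : ℕ) :
    ∃ r : ℕ, r.Prime ∧ r ∉ S ∧ r ≡ 1 [MOD t ^ M] ∧ (((W.LFunction r : ℤ) : ZMod 2)) ≠ (r : ZMod 2) + 1 :=
  exists_prime_modEq_one_lFunction_odd_of_mod_three W hirr ht ht3 S M

end Summit.BirchSwinnertonDyer.BirchSwinnertonDyer.Theorems.ManinLocalTwoThree

end
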